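import Summits.BirchSwinnertonDyer.BirchSwinnertonDyer.Theorems.QuadraticBranchSignedControlPlusEtaLowerInclusionOfMissingLowerBound
import Summits.BirchSwinnertonDyer.BirchSwinnertonDyer.Theorems.QuadraticBranchSignedControlPlusEtaLowerInclusionRung39675m1
import Summits.BirchSwinnertonDyer.BirchSwinnertonDyer.Theorems.QuadraticBranchSignedControlPlusEtaR0KuriharaRecords01
import Summits.BirchSwinnertonDyer.BirchSwinnertonDyer.Theorems.QuadraticBranchSignedControlPlusEtaR0KuriharaRecords02
import Summits.BirchSwinnertonDyer.BirchSwinnertonDyer.Theorems.QuadraticBranchSignedControlPlusEtaR0KuriharaRecords03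
import Summits.BirchSwinnertonDyer.BirchSwinnertonDyer.Theorems.QuadraticBranchSignedControlPlusEtaR0KuriharaRecords04
import HarnessLib

/-!
# Route `QuadraticBranchSignedControl` (rung K8, cell `bsd-potss`), crux `PlusEtaLowerInclusion`
# (stmt-BirchSwinnertonDyer-19601): THE RANK-0 TOWER-ONTO ROWS, COMPOSED — Kobayashi's Eisenstein
# inclusion (E⁺_η) AND the even main conjecture (C1⁺_η) at `η = ω^{(p−1)/2}` for EVERY tower-onto good
# supersingular twist `V` of each CERTIFIED additive partner `W`, from the named facts and ONE unit
# Kurihara number per row (seat `bsd-potss-k8eta-c1`, gen 2; `--supports` crux 19601)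

WHAT. The registered skeleton v3 of crux 19601 (plan g16, sha d4fe3135…) cuts the rank-`0` rows into
`stub_etaLower_r0_lowerBSD` (L₀ = `MissingLowerBoundAt W p` on the additive Gss2 partners `W` of the
`p`-adic-tower-onto good supersingular twists `V`, `a_p(V) = 0`, `p ≥ 5`, `L(W,1) ≠ 0`) and
`stub_etaLower_r0_ofLowerBSD` (the named facts ⟹ (L₀(W) ⟹ (E⁺_η)(V))), the latter = ctrl g4's LANDED
`ConverseControl.quadraticBranchPlusEtaLowerInclusionAt_of_missingLowerBoundAt_of_surjective` (p463421).
The sibling record files `…PlusEtaR0KuriharaRecordsNN.lean` (this seat) certify L₀ PER ROW on the census's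
rank-`0` tower-onto rows (kit j255146: 19 rows; kit kit j260432: unit Kurihara numbers, kt-kur5 g0's engine bundle
unmodified) — `PlusEtaR0Kurihara.etaR0_kur_v<label>_<p>`, with global minimality / `Δ ≠ 0` / `ρ̄_{W,p}`
onto / the Kolyvagin level IN THE KERNEL. THIS FILE composes the two:
* §1 `etaPair_of_rankZero_of_missingLowerBoundAt` — generic: named facts (`hPT`, `hmod`, GZK, Kobayashi
  2.2_η / 4.1_η, Kitajima–Otsuki 1.3_η) + `W.analyticRank = 0` + `MissingLowerBoundAt W p` ⟹ for every
  globally minimal `V` with `C • W^{(p*)} = V`, good at `p`, `a_p(V) = 0`, `ρ_{V,p^m}` onto for all `m`: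
  (E⁺_η)(V,p) ∧ (C1⁺_η)(V,p) (Kobayashi's even main conjecture at `η` IN FULL at the pair);
  `etaPair_of_rankZero_of_shaAn_eq` — the same from the EXACT analytic Sha `#Ш(W)_an = s ∈ ℕ`, `p ∤ s`
  (L₀ trivial; the four Tamagawa-defect rows with `ord₅ Tam(W) = 2`, `#Ш_an ∈ {1, 4}`);
* §2 one corollary per CERTIFIED row: `etaPair_r0_v<label>_<p>` — statement shape of the registered rung
  `stub_etaLower_rung_39675m1_inputs` (k8-rung p465828) generalised to the row: named facts + Kim 2026
  Thm. 1.8 (6) (`hKim`) + the DISPLAYED row data (`r_an(W) = 0`, the optimal datum, Cremona's Manin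
  computation `h300` or the Manin binder, the Kurihara VALUE at the named level) ⟹ ∀ good tower-onto
  twists `V` of `W`, (E⁺_η)(V,p) ∧ (C1⁺_η)(V,p);
* §3 the Ш_an-unit Tamagawa rows: `etaPair_r0_v<label>_<p>` from `#Ш(W)_an = s` DISPLAYED (`hsha`, ONE
  exact rational — modular symbols; Cremona `allbsd`) instead of a Kurihara number (none exists at depth
  `k ≤ 2` there: `∂^(∞) = ord_p ∏ c_ℓ = 2`).
The row table (which road, which per-row input, which job) is in each docstring; the residue of the
19 rows NOT reached here is listed at the end of this docstring.

RESIDUE of the 19 rank-0 tower-onto rows (honest): 16 rows reach (E⁺_η) ∧ (C1⁺_η) in parts 01–03 — 12 by a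
unit Kurihara number (39675m1, 80550g1, 137775i1, 211600eb1, 218450n1, 291525bp1, 296400do1, 302050f1,
333975m1, 444900i1, 449650br1 @5; 254310t1 @7) and 4 by the exact analytic Sha (168150g1, 231650m1,
248550l1, 321450n1 @5: the Tamagawa-defect rows with `#Ш_an` a 5-adic unit); 3 rows are NOT reached:
288600bn1 @5 (`ord₅ ∏c_ℓ = 1`, `ord₅ #Ш_an = 2`: needs a depth-2 certificate — smallest cyclic pair level
in 𝒩₂ is 59242901, series length 1.1·10¹¹, beyond the cap — or a 5-descent showing `5² ∣ #Ш(W)`),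
414150cd1 @5 (`δ̃_n ≡ 0 (mod 5)` at ALL 7 cyclic pair levels tried — 19291, 49591, 75851, 93781, 100091,
103121, 104131 — and at the 4 levels of additive-p4 GEN22 V41; an anomaly against Kim's conjectural
`∂^(∞) = ord_p ∏c_ℓ = 0` only if it persisted over all of 𝒩₁; flagged, not resolved), 141512r1 @7
(smallest cyclic pair level 220459, series length 2.9·10⁸ > cap). The 21 rank-1 rows are untouched.

HONEST LABEL (cell `bsd-potss`, HUMAN RULING D-0036/D-0074/D-0088(2)): every theorem is CONDITIONAL on
NAMED facts in hypothesis position (Poitou–Tate duality for Selmer structures, modularity, GZK,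
Kobayashi 2003 Thm. 2.2/4.1 at `η`, Kitajima–Otsuki 2018 Thm. 1.3 at `η`, Kim 2026 Thm. 1.8 (6),
Cremona's Manin computation) and on DISPLAYED per-row data (analytic rank `0`, the optimal datum, the
Kurihara value / the exact analytic Sha); these are PER-ROW INSTANCES of the registered stubs' slots,
not the class-wide stubs (`stub_etaLower_r0_lowerBSD` = Kato's lower inclusion for `f_W`, OPEN;
`stub_etaLower_offLocus`, OPEN); crux 19601 is NOT closed; nothing is booked; `BSD(W,p)` is claimed for
no row; the rank-`1` rows (21) are untouched (the constant-term squeeze is void there). No `sorry`, no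
new definition, axioms standard.

References: [Kobayashi2003] §4 Even MC + Thm. 4.1 (p. 8), Thm. 2.2 (p. 5); [KitajimaOtsuki2018] Thm. 1.3;
[Kim2022StructureSelmer] Thm. 1.9 (6) (= AJM 148 (2026) Thm. 1.8 (6)); [MilneADT2006] Thm. I.4.10;
[Miller2011LMS] Def. 1.1; [Cremona1997] Table 1 / `allbsd`; [GreenbergLNM1716] Lemma 4.2.
-/

set_option autoImplicit false
-- sibling precedent (`…PlusEtaLowerInclusionRung39675m1.lean`): the directory name repeats the summit name
set_option linter.dupNamespace false

noncomputable section

open scoped Classical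

open CongruenceSubgroup WeierstrassCurve Literature.NumberTheory.EllipticCurves
open Literature.NumberTheory.EllipticCurves.ModularForms
open Literature.NumberTheory.EllipticCurves.Rank1Residual
open Literature.NumberTheory.EllipticCurves.Rank1Residual.Typed
open Literature.NumberTheory.EllipticCurves.Rank1Residual.X11RankOneCertificates
open Literature.NumberTheory.GaloisRepresentations
open Literature.NumberTheory.GaloisCohomology
open Summit.BirchSwinnertonDyer.Rank1Residual
open Summit.BirchSwinnertonDyer.Rank1Residual.Additive
open Summit.BirchSwinnertonDyer.Rank1Residual.X4
open Summit.BirchSwinnertonDyer.Rank1Residual.X11b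
open Summit.BirchSwinnertonDyer.Rank1Residual.Supersingular
open Summit.BirchSwinnertonDyer.BirchSwinnertonDyer.Rank1Residual.IntModel
open Summit.BirchSwinnertonDyer.BirchSwinnertonDyer.Rank1Residual.X11RankOne

namespace Summit.BirchSwinnertonDyer.BirchSwinnertonDyer.Theorems.PlusEtaR0Rows

/-! ## §1 Generic compositions (any tower-onto rank-0 Gss2 pair, `p ≥ 5`) -/

/-- **(E⁺_η) ∧ (C1⁺_η) at every tower-onto good supersingular twist of a rank-`0` additive partner with
the LOWER half of `BSD_p`** — ctrl g4's converse road (p463421, both conclusions) with `L(W,1) ≠ 0`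
read off `W.analyticRank = 0` by modularity. INPUTS: `hPT`, `hmod`, GZK, Kobayashi Thm. 2.2/4.1 at
`η`, Kitajima–Otsuki 1.3 at `η` (NAMED facts), `W.analyticRank = 0`, `MissingLowerBoundAt W p`; the
pair: `C • W^{(p*)} = V` globally minimal, good at `p`, `a_p(V) = 0`, `ρ_{V,p^m}` onto for all `m`.
CONDITIONAL; nothing booked. [cite: Kobayashi2003, §4 Even main conjecture and Thm. 4.1 (p. 8), Thm. 2.2 (p. 5)]
[cite: Miller2011LMS, Def. 1.1] -/
theorem etaPair_of_rankZero_of_missingLowerBoundAt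
    (hPT : poitouTate_selmerStructure_duality_real ℚ) (hmod : hasEntireLFunction_rat)
    (hGZK : rank_eq_analyticRank_of_analyticRank_le_one)
    (h22 : Kobayashi2003.thm22_etaSignedSelmerDual_finite_torsion)
    (h41 : Kobayashi2003.thm41_plusEtaCharIdeal_dvd)
    (hKO : KitajimaOtsuki2018.mainThm13_etaSignedSelmerDual_noFiniteSubmodule)
    (W : WeierstrassCurve ℚ) [W.IsElliptic] [W.IsGloballyMinimal] (p : ℕ) [Fact p.Prime] (hp5 : 5 ≤ p)
    (hr : W.analyticRank = 0) (hlow : MissingLowerBoundAt W p)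
    (V : WeierstrassCurve ℚ) [V.IsElliptic] [V.IsGloballyMinimal] (C : VariableChange ℚ)
    (hCV : C • W.quadraticTwist ((-1) ^ (p / 2) * p) = V)
    (hgood : V.HasGoodReductionAtPrime p) (hap : V.frobeniusTrace p = 0)
    (hsurj : ∀ m : ℕ, V.HasSurjectiveModNGaloisRep (p ^ m : ℕ)) :
    QuadraticBranchPlusEtaLowerInclusionAt V p ∧ QuadraticBranchPlusEtaMainConjectureAt V p := by
  have hLW : W.entireLFunction 1 ≠ 0 := (W.analyticRank_eq_zero_iff_holds (hmod W)).mp hr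
  exact ⟨ConverseControl.quadraticBranchPlusEtaLowerInclusionAt_of_missingLowerBoundAt_of_surjective W p
      hPT hmod hGZK h22 h41 hKO V C hp5 hCV hgood hap hsurj hLW hlow,
    ConverseControl.quadraticBranchPlusEtaMainConjectureAt_of_missingLowerBoundAt_of_surjective W p
      hPT hmod hGZK h22 h41 hKO V C hp5 hCV hgood hap hsurj hLW hlow⟩

/-- **(E⁺_η) ∧ (C1⁺_η) at every tower-onto good supersingular twist of a rank-`0` additive partner
whose EXACT analytic Sha is a natural number prime to `p`** (`shaAn W = s`, `p ∤ s`): then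
`MissingLowerBoundAt W p` holds trivially (`v_p(s) = 0 ≤ ord_p #Ш(W)`) — the road for the
Tamagawa-defect rows whose `#Ш_an` is a `p`-adic unit, where no Kurihara certificate of depth
`k ≤ ord_p ∏ c_ℓ` can exist. The per-row analytic input is ONE exact rational number. CONDITIONAL;
nothing booked. [cite: Kobayashi2003, §4 Even main conjecture and Thm. 4.1 (p. 8)] [cite: Miller2011LMS, §1 and Def. 1.1] -/
theorem etaPair_of_rankZero_of_shaAn_eq
    (hPT : poitouTate_selmerStructure_duality_real ℚ) (hmod : hasEntireLFunction_rat)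
    (hGZK : rank_eq_analyticRank_of_analyticRank_le_one)
    (h22 : Kobayashi2003.thm22_etaSignedSelmerDual_finite_torsion)
    (h41 : Kobayashi2003.thm41_plusEtaCharIdeal_dvd)
    (hKO : KitajimaOtsuki2018.mainThm13_etaSignedSelmerDual_noFiniteSubmodule)
    (W : WeierstrassCurve ℚ) [W.IsElliptic] [W.IsGloballyMinimal] (p : ℕ) [Fact p.Prime] (hp5 : 5 ≤ p)
    (hr : W.analyticRank = 0) (s : ℕ) (hs : shaAn W = (s : ℂ)) (hps : ¬ p ∣ s)
    (V : WeierstrassCurve ℚ) [V.IsElliptic] [V.IsGloballyMinimal] (C : VariableChange ℚ)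
    (hCV : C • W.quadraticTwist ((-1) ^ (p / 2) * p) = V)
    (hgood : V.HasGoodReductionAtPrime p) (hap : V.frobeniusTrace p = 0)
    (hsurj : ∀ m : ℕ, V.HasSurjectiveModNGaloisRep (p ^ m : ℕ)) :
    QuadraticBranchPlusEtaLowerInclusionAt V p ∧ QuadraticBranchPlusEtaMainConjectureAt V p := by
  have hlow : MissingLowerBoundAt W p := by
    refine ⟨(s : ℚ), by rw [hs]; push_cast; rfl, ?_⟩
    rw [padicValRat.of_nat, Nat.cast_le, padicValNat.eq_zero_of_not_dvd hps]
    exact Nat.zero_le _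
  exact etaPair_of_rankZero_of_missingLowerBoundAt hPT hmod hGZK h22 h41 hKO W p hp5 hr hlow V C hCV
    hgood hap hsurj

/-! ## §2 The certified rows (one unit Kurihara number each) — first rows; the rest in parts 02… -/

-- the L₀ record of THIS row is inlined here: its `Δ ≠ 0` / minimality theorems are the landed k8-rung ones (p461640), whose module lies in this file's import cone and not in the route-free records files
-- `decide` evaluates `discOf`/`c4Of`/`c6Of`, the Kraus tests and the schema point counts on the literal coefficients
set_option maxRecDepth 100000 in
/-- **L₀ = `ord_5 #Ш_an ≤ ord_5 #Ш` for the additive Gss2 partner `W = 39675m1`** (Cremona's minimal model `[0, -1, 1, -506958, -159508807]`, `N = 39675 = 5²·1587`;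
additive `e = 2` at `5` (Kodaira `I0*`), its minimal `5*`-twist `V = 1587d1` GOOD SUPERSINGULAR with `a_5(V) = 0` and `ρ_{V,5^∞}` onto — a RANK-0
TOWER-ONTO row of crux 19601's census j255146; `r_an(W) = 0`, `#Ш_an = 25`, `∏ c_ℓ = 2`, `#W(ℚ)_tors = 1`; isogeny class of 1 curve(s), `5 ∣ #Ш_an` at every member).
IN THE KERNEL: minimality and `Δ ≠ 0` REUSED from the landed `isGloballyMinimal_39675m1` / `isElliptic_39675m1` (k8-rung g0, p461640); `Δ ≠ 0`; `ρ̄_{W,5}` onto by Serre Prop. 19 witnesses (i) `q = 17`: `#W̃ = 10`, `a = 8`, `a² − 4q ≡ 4²`,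
(ii) `q = 7`: `#W̃ = 9`, `a = -1`, Euler `−1`, (iii) `q = 7`: `#W̃ = 9`, `a = -1`, `u = 3`; the level `n = 31·461 = 14291 ∈ 𝒩₁(W,5)`:
`#W̃(𝔽_{31}) = 40` (kernel), `#W̃(𝔽_{461}) = 460` (kernel), both `≡ 0 (mod 5)`, `≢ 0 (mod 5²)`
(cyclic `5`-torsion).
EVIDENCE (value binder `hδ`): `δ̃_{14291} ≡ 2 (mod 5)` — engine Bf kit j260432 (`D = 2`, rounding deviation `3.3e-09`, exact Hecke relations `490`/0 failed,
`[0]⁺ = 50` = BSD value); second source: engine B UNMODIFIED (d6da695bc822) at the first certified level 6541: identical delta=2 D=2 | additive-p4 GEN22 V41 j135839 N0=1587 unit@6541 values={4681: 0, 6541: 2}. Manin: `N ≤ 300000`, `|c_D| = 1` by the named database fact `h300`.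
CONDITIONAL on `hKim` (Kim 2026 Thm. 1.8 (6), PUBLISHED), GZK, modularity, Cremona's Manin computation (`h300`); a per-row instance of the registered stub `stub_etaLower_r0_lowerBSD` (item 19601),
NOT the class-wide stub; nothing booked; `BSD(W,5)` not claimed.
[cite: Kim2022StructureSelmer, Thm. 1.9 (6) (PDF p. 8), §1.2.2, §1.4.3] [cite: Serre1972, §2.8 Prop. 19] [cite: Cremona1997, Table 1 (label 39675m1), §2.8] [cite: Miller2011LMS, Def. 1.1] -/
theorem etaR0_kur_v39675m1_5 (hKim : Kim2026.rankZero_le_padicValNat_sha_of_kuriharaNumber_ne_zero)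
    (hGZK : rank_eq_analyticRank_of_analyticRank_le_one) (hmod : hasEntireLFunction_rat)
    (h300 : cremona_abs_maninConstant_eq_one_of_level_le_300000)
    (W : WeierstrassCurve ℚ) (hW : W = ⟨0, -1, 1, -506958, -159508807⟩)
    (hr : W.analyticRank = 0) (D : ModularParametrizationData W 39675)
    (hopt : ∀ z ∈ D.L.lattice, ∃ w ∈ periodLattice D.f, z = D.c * w)
    (hδ : ∃ ψ : (ℓ : ℕ) → (ZMod ℓ)ˣ →* Multiplicative (ZMod (5 ^ 1)),
      (∀ ℓ ∈ (31 * 461 : ℕ).primeFactors, Function.Surjective (ψ ℓ)) ∧ kuriharaNumber D.f (5 ^ 1) (31 * 461) ψ ≠ 0) :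
    MissingLowerBoundAt W 5 := by
  subst hW
  have hmin : (⟨0, -1, 1, -506958, -159508807⟩ : WeierstrassCurve ℚ).IsGloballyMinimal := isGloballyMinimal_39675m1
  haveI := hmin
  haveI : (⟨0, -1, 1, -506958, -159508807⟩ : WeierstrassCurve ℚ).IsElliptic := isElliptic_39675m1
  have hI : integralModelInt (⟨0, -1, 1, -506958, -159508807⟩ : WeierstrassCurve ℚ) = (⟨0, -1, 1, -506958, -159508807⟩ : WeierstrassCurve ℤ) :=
    integralModelInt_eq_of_map_eq _ (map_mk_int 0 (-1) 1 (-506958) (-159508807))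
  have hsurj : Surj (⟨0, -1, 1, -506958, -159508807⟩ : WeierstrassCurve ℚ) 5 :=
    @surj_of_ainvs_of_serreWitnesses 0 (-1) 1 (-506958) (-159508807) 5 ⟨by norm_num⟩ (by norm_num) hmin
      17 7 7 (by norm_num) (by norm_num) (by norm_num) (by decide) (by decide) (by decide)
      (by decide) (by decide) (by decide) (by decide +kernel) (by decide +kernel) (by decide +kernel)
      (n₁ := 10) (n₂ := 9) (n₃ := 9) (by decide +kernel) (by decide +kernel) (by decide +kernel)
      (4 : ZMod 5) (3 : ZMod 5) (by decide +kernel) (by decide +kernel) (by decide +kernel)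
  -- the `Fact p.Prime` instance enters only now: the `decide` goals above must be closed terms
  haveI hp : Fact (Nat.Prime 5) := ⟨by norm_num⟩
  haveI : Fact (Nat.Prime 31) := ⟨by norm_num⟩
  haveI : Fact (Nat.Prime 461) := ⟨by norm_num⟩
  have hc₁ := natCard_point_eq_of_countPoints 0 (-1) 1 (-506958) (-159508807) 31 (by norm_num) (by decide +kernel) (n := 40) (by decide +kernel)
  have hc₂ := natCard_point_eq_of_countPoints 0 (-1) 1 (-506958) (-159508807) 461 (by norm_num) (by decide +kernel) (n := 460) (by decide +kernel)
  have hk₁ : Kato.IsKolyvaginPrime (⟨0, -1, 1, -506958, -159508807⟩ : WeierstrassCurve ℚ) 5 1 31 :=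
    isKolyvaginPrime_of_intModel_of_card hI 5 1 31 (by norm_num) (by rw [intCurve_Δ]; decide +kernel) (by decide) hc₁ (by norm_num)
  have hk₂ : Kato.IsKolyvaginPrime (⟨0, -1, 1, -506958, -159508807⟩ : WeierstrassCurve ℚ) 5 1 461 :=
    isKolyvaginPrime_of_intModel_of_card hI 5 1 461 (by norm_num) (by rw [intCurve_Δ]; decide +kernel) (by decide) hc₂ (by norm_num)
  haveI : NeZero (31 * 461 : ℕ) := ⟨by norm_num⟩
  have hc : ¬ ((5 : ℕ) : ℤ) ∣ D.maninConstant :=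
    not_dvd_maninConstant_of_level_le_300000 h300 _ D hopt (by norm_num) hp.out
  obtain ⟨ψ, hψ, hδ⟩ := hδ
  exact X4.missingLowerBoundAt_rankZero_of_kimLower _ 5 hKim hGZK (by norm_num) hsurj
    (((⟨0, -1, 1, -506958, -159508807⟩ : WeierstrassCurve ℚ).analyticRank_eq_zero_iff_holds (hmod _)).mp hr) D hc (periodTransfer_of_optimal 5 D hopt hc)
    1 (31 * 461) le_rfl (Nat.le_add_left 1 _) (isKolyvaginProduct_mul hk₁ hk₂ (by norm_num))
    (forall_card_torsion_le_of_pair hI 5 31 461 hc₁ hc₂ (by norm_num) (by norm_num)) ψ hψ hδ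

/-- **(E⁺_η) ∧ (C1⁺_η) at `p = 5` for EVERY tower-onto good twist of `W = 39675m1`** (Cremona's minimal model `[0, -1, 1, -506958, -159508807]`,
`N = 39675 = 5²·1587`, additive `e = 2` at `5`; minimal `5*`-twist `V = 1587d1`: good supersingular, `a_5(V) = 0`, `ρ_{V,5^∞}` onto,
`r_an(V) = 1` — census kit j255146; `r_an(W) = 0`, `#Ш(W)_an = 25`, `∏ c_ℓ(W) = 2`, `#W(ℚ)_tors = 1`): the named facts + Kim 2026 Thm. 1.8 (6)
+ the DISPLAYED row data (`r_an(W) = 0`; the optimal datum; Cremona's Manin computation `h300` (`N ≤ 300000`); the unit Kurihara number `δ̃_{14291} ≢ 0 (mod 5)` at the cyclic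
pair level `n = 31·461 ∈ 𝒩₁(W,5)`, kit j260432) give L₀(W,5) by the record `etaR0_kur_v39675m1_5`
(minimality, `Δ ≠ 0`, surjectivity of `ρ̄_{W,5}` and the level IN THE KERNEL there), whence the pair's (E⁺_η) and (C1⁺_η) by §1.
Statement shape = the registered rung `stub_etaLower_rung_39675m1_inputs` generalised to this row. CONDITIONAL; a per-row instance; nothing booked; `BSD(W,5)` not claimed.
[cite: Kobayashi2003, §4 Even main conjecture and Thm. 4.1 (p. 8)] [cite: Kim2022StructureSelmer, Thm. 1.9 (6) (PDF p. 8)] [cite: Cremona1997, Table 1 (label 39675m1)] -/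
theorem etaPair_r0_v39675m1_5
    (hPT : poitouTate_selmerStructure_duality_real ℚ) (hmod : hasEntireLFunction_rat)
    (hGZK : rank_eq_analyticRank_of_analyticRank_le_one)
    (h22 : Kobayashi2003.thm22_etaSignedSelmerDual_finite_torsion)
    (h41 : Kobayashi2003.thm41_plusEtaCharIdeal_dvd)
    (hKO : KitajimaOtsuki2018.mainThm13_etaSignedSelmerDual_noFiniteSubmodule)
    (hKim : Kim2026.rankZero_le_padicValNat_sha_of_kuriharaNumber_ne_zero)
    (h300 : cremona_abs_maninConstant_eq_one_of_level_le_300000)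
    (W : WeierstrassCurve ℚ) (hW : W = ⟨0, -1, 1, -506958, -159508807⟩)
    (hr : W.analyticRank = 0) (D : ModularParametrizationData W 39675)
    (hopt : ∀ z ∈ D.L.lattice, ∃ w ∈ periodLattice D.f, z = D.c * w)
    (hδ : ∃ ψ : (ℓ : ℕ) → (ZMod ℓ)ˣ →* Multiplicative (ZMod (5 ^ 1)),
      (∀ ℓ ∈ (31 * 461 : ℕ).primeFactors, Function.Surjective (ψ ℓ)) ∧ kuriharaNumber D.f (5 ^ 1) (31 * 461) ψ ≠ 0) :
    ∀ (V : WeierstrassCurve ℚ) [V.IsElliptic] [V.IsGloballyMinimal] [Fact (5 : ℕ).Prime],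
      (∃ C : VariableChange ℚ, C • W.quadraticTwist 5 = V) →
      V.HasGoodReductionAtPrime 5 → V.frobeniusTrace 5 = 0 →
      (∀ m : ℕ, V.HasSurjectiveModNGaloisRep (5 ^ m : ℕ)) →
        QuadraticBranchPlusEtaLowerInclusionAt V 5 ∧ QuadraticBranchPlusEtaMainConjectureAt V 5 := by
  have hlow : MissingLowerBoundAt W 5 :=
    etaR0_kur_v39675m1_5 hKim hGZK hmod h300 W hW hr D hopt hδ
  subst hW
  haveI := isElliptic_39675m1
  haveI := isGloballyMinimal_39675m1
  intro V _ _ _ hC hgood hap hsurj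
  obtain ⟨C, hCV⟩ := hC
  have hD : ((-1 : ℚ) ^ ((5 : ℕ) / 2) * ((5 : ℕ) : ℚ)) = 5 := by norm_num
  exact etaPair_of_rankZero_of_missingLowerBoundAt hPT hmod hGZK h22 h41 hKO _ 5 (by norm_num) hr hlow V C
    (by rw [hD]; exact hCV) hgood hap hsurj

/-- **(E⁺_η) ∧ (C1⁺_η) at `p = 5` for EVERY tower-onto good twist of `W = 80550g1`** (Cremona's minimal model `[1, -1, 0, -16515117, -25828618959]`,
`N = 80550 = 5²·3222`, additive `e = 2` at `5`; minimal `5*`-twist `V = 3222e1`: good supersingular, `a_5(V) = 0`, `ρ_{V,5^∞}` onto,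
`r_an(V) = 1` — census kit j255146; `r_an(W) = 0`, `#Ш(W)_an = 25`, `∏ c_ℓ(W) = 8`, `#W(ℚ)_tors = 2`): the named facts + Kim 2026 Thm. 1.8 (6)
+ the DISPLAYED row data (`r_an(W) = 0`; the optimal datum; Cremona's Manin computation `h300` (`N ≤ 300000`); the unit Kurihara number `δ̃_{11041} ≢ 0 (mod 5)` at the cyclic
pair level `n = 61·181 ∈ 𝒩₁(W,5)`, kit j260432) give L₀(W,5) by the record `PlusEtaR0Kurihara.etaR0_kur_v80550g1_5`
(minimality, `Δ ≠ 0`, surjectivity of `ρ̄_{W,5}` and the level IN THE KERNEL there), whence the pair's (E⁺_η) and (C1⁺_η) by §1.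
Statement shape = the registered rung `stub_etaLower_rung_39675m1_inputs` generalised to this row. CONDITIONAL; a per-row instance; nothing booked; `BSD(W,5)` not claimed.
[cite: Kobayashi2003, §4 Even main conjecture and Thm. 4.1 (p. 8)] [cite: Kim2022StructureSelmer, Thm. 1.9 (6) (PDF p. 8)] [cite: Cremona1997, Table 1 (label 80550g1)] -/
theorem etaPair_r0_v80550g1_5
    (hPT : poitouTate_selmerStructure_duality_real ℚ) (hmod : hasEntireLFunction_rat)
    (hGZK : rank_eq_analyticRank_of_analyticRank_le_one)
    (h22 : Kobayashi2003.thm22_etaSignedSelmerDual_finite_torsion)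
    (h41 : Kobayashi2003.thm41_plusEtaCharIdeal_dvd)
    (hKO : KitajimaOtsuki2018.mainThm13_etaSignedSelmerDual_noFiniteSubmodule)
    (hKim : Kim2026.rankZero_le_padicValNat_sha_of_kuriharaNumber_ne_zero)
    (h300 : cremona_abs_maninConstant_eq_one_of_level_le_300000)
    (W : WeierstrassCurve ℚ) (hW : W = ⟨1, -1, 0, -16515117, -25828618959⟩)
    (hr : W.analyticRank = 0) (D : ModularParametrizationData W 80550)
    (hopt : ∀ z ∈ D.L.lattice, ∃ w ∈ periodLattice D.f, z = D.c * w)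
    (hδ : ∃ ψ : (ℓ : ℕ) → (ZMod ℓ)ˣ →* Multiplicative (ZMod (5 ^ 1)),
      (∀ ℓ ∈ (61 * 181 : ℕ).primeFactors, Function.Surjective (ψ ℓ)) ∧ kuriharaNumber D.f (5 ^ 1) (61 * 181) ψ ≠ 0) :
    ∀ (V : WeierstrassCurve ℚ) [V.IsElliptic] [V.IsGloballyMinimal] [Fact (5 : ℕ).Prime],
      (∃ C : VariableChange ℚ, C • W.quadraticTwist 5 = V) →
      V.HasGoodReductionAtPrime 5 → V.frobeniusTrace 5 = 0 →
      (∀ m : ℕ, V.HasSurjectiveModNGaloisRep (5 ^ m : ℕ)) →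
        QuadraticBranchPlusEtaLowerInclusionAt V 5 ∧ QuadraticBranchPlusEtaMainConjectureAt V 5 := by
  have hlow : MissingLowerBoundAt W 5 :=
    PlusEtaR0Kurihara.etaR0_kur_v80550g1_5 hKim hGZK hmod h300 W hW hr D hopt hδ
  subst hW
  haveI := PlusEtaR0Kurihara.isElliptic_v80550g1
  haveI := PlusEtaR0Kurihara.isGloballyMinimal_v80550g1
  intro V _ _ _ hC hgood hap hsurj
  obtain ⟨C, hCV⟩ := hC
  have hD : ((-1 : ℚ) ^ ((5 : ℕ) / 2) * ((5 : ℕ) : ℚ)) = 5 := by norm_num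
  exact etaPair_of_rankZero_of_missingLowerBoundAt hPT hmod hGZK h22 h41 hKO _ 5 (by norm_num) hr hlow V C
    (by rw [hD]; exact hCV) hgood hap hsurj

/-- **(E⁺_η) ∧ (C1⁺_η) at `p = 5` for EVERY tower-onto good twist of `W = 137775i1`** (Cremona's minimal model `[1, 1, 0, -1514700, -718156125]`,
`N = 137775 = 5²·5511`, additive `e = 2` at `5`; minimal `5*`-twist `V = 5511d1`: good supersingular, `a_5(V) = 0`, `ρ_{V,5^∞}` onto,
`r_an(V) = 0` — census kit j255146; `r_an(W) = 0`, `#Ш(W)_an = 25`, `∏ c_ℓ(W) = 4`, `#W(ℚ)_tors = 2`): the named facts + Kim 2026 Thm. 1.8 (6)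
+ the DISPLAYED row data (`r_an(W) = 0`; the optimal datum; Cremona's Manin computation `h300` (`N ≤ 300000`); the unit Kurihara number `δ̃_{46031} ≢ 0 (mod 5)` at the cyclic
pair level `n = 191·241 ∈ 𝒩₁(W,5)`, kit j260432) give L₀(W,5) by the record `PlusEtaR0Kurihara.etaR0_kur_v137775i1_5`
(minimality, `Δ ≠ 0`, surjectivity of `ρ̄_{W,5}` and the level IN THE KERNEL there), whence the pair's (E⁺_η) and (C1⁺_η) by §1.
Statement shape = the registered rung `stub_etaLower_rung_39675m1_inputs` generalised to this row. CONDITIONAL; a per-row instance; nothing booked; `BSD(W,5)` not claimed.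
[cite: Kobayashi2003, §4 Even main conjecture and Thm. 4.1 (p. 8)] [cite: Kim2022StructureSelmer, Thm. 1.9 (6) (PDF p. 8)] [cite: Cremona1997, Table 1 (label 137775i1)] -/
theorem etaPair_r0_v137775i1_5
    (hPT : poitouTate_selmerStructure_duality_real ℚ) (hmod : hasEntireLFunction_rat)
    (hGZK : rank_eq_analyticRank_of_analyticRank_le_one)
    (h22 : Kobayashi2003.thm22_etaSignedSelmerDual_finite_torsion)
    (h41 : Kobayashi2003.thm41_plusEtaCharIdeal_dvd)
    (hKO : KitajimaOtsuki2018.mainThm13_etaSignedSelmerDual_noFiniteSubmodule)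
    (hKim : Kim2026.rankZero_le_padicValNat_sha_of_kuriharaNumber_ne_zero)
    (h300 : cremona_abs_maninConstant_eq_one_of_level_le_300000)
    (W : WeierstrassCurve ℚ) (hW : W = ⟨1, 1, 0, -1514700, -718156125⟩)
    (hr : W.analyticRank = 0) (D : ModularParametrizationData W 137775)
    (hopt : ∀ z ∈ D.L.lattice, ∃ w ∈ periodLattice D.f, z = D.c * w)
    (hδ : ∃ ψ : (ℓ : ℕ) → (ZMod ℓ)ˣ →* Multiplicative (ZMod (5 ^ 1)),
      (∀ ℓ ∈ (191 * 241 : ℕ).primeFactors, Function.Surjective (ψ ℓ)) ∧ kuriharaNumber D.f (5 ^ 1) (191 * 241) ψ ≠ 0) :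
    ∀ (V : WeierstrassCurve ℚ) [V.IsElliptic] [V.IsGloballyMinimal] [Fact (5 : ℕ).Prime],
      (∃ C : VariableChange ℚ, C • W.quadraticTwist 5 = V) →
      V.HasGoodReductionAtPrime 5 → V.frobeniusTrace 5 = 0 →
      (∀ m : ℕ, V.HasSurjectiveModNGaloisRep (5 ^ m : ℕ)) →
        QuadraticBranchPlusEtaLowerInclusionAt V 5 ∧ QuadraticBranchPlusEtaMainConjectureAt V 5 := by
  have hlow : MissingLowerBoundAt W 5 :=
    PlusEtaR0Kurihara.etaR0_kur_v137775i1_5 hKim hGZK hmod h300 W hW hr D hopt hδ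
  subst hW
  haveI := PlusEtaR0Kurihara.isElliptic_v137775i1
  haveI := PlusEtaR0Kurihara.isGloballyMinimal_v137775i1
  intro V _ _ _ hC hgood hap hsurj
  obtain ⟨C, hCV⟩ := hC
  have hD : ((-1 : ℚ) ^ ((5 : ℕ) / 2) * ((5 : ℕ) : ℚ)) = 5 := by norm_num
  exact etaPair_of_rankZero_of_missingLowerBoundAt hPT hmod hGZK h22 h41 hKO _ 5 (by norm_num) hr hlow V C
    (by rw [hD]; exact hCV) hgood hap hsurj

end Summit.BirchSwinnertonDyer.BirchSwinnertonDyer.Theorems.PlusEtaR0Rows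

end
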